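import Literature.Computability.Cryptography.RegevSamplerMachineCos
import HarnessLib

/-!
# Regev 2009, Lemma 3.14 in machine form: the precision schedule of the cosine machine

Topic `Literature/Computability/Cryptography`, grouping namespace `Regev2009.SamplerRegs`; sequel of
`RegevSamplerMachineCos.lean` (`etaCos ℓ k_A p μ c`: the explicit one-block preparation error of the
Grover–Rudolph stage with the cosine machine). Here the error is BOUNDED under a concrete schedule of the
machine's precisions in a security parameter `m` (Regev 2009, Lemma 3.12, proof, with §2 p. 11: "all
quantities are computed to within `2^{-poly}`"):

* `third_le_gaussF_one`, **`third_le_total_cellW`** — the total cell mass `W = ∫_{-2^{ℓ-1}}^{2^{ℓ-1}} e^{-ct²} dt`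
  is at least `1/3` for `c ≤ 1` (so the bad-mass term `2^ℓ μ/W` is at most `3·2^ℓ μ`);
* **`etaCos_le`** — the generic bound `etaCos ≤ 6ℓ√ε + 2c(2·2^ℓ + 1)` whenever
  `2/2^{k_A} ≤ ε`, `3(2/2^p)/μ ≤ ε²`, `2^ℓ μ ≤ ε²`, `ε ≤ 1`;
* **`etaCos_schedule_le`** — with `k_A := 2m + 1`, `p := 4(2m + ℓ + 3)`, `μ := 8/4^{2m+ℓ+3}`:
  `etaCos ≤ 6ℓ·2^{-m} + 2c(2·2^ℓ + 1)`, together with the side conditions `schedule_mu_pos`,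
  `schedule_delta_le_mu` (`4·(2/2^p) ≤ μ`) required by `tvDist_machineCirc_le_cos`.

Everything here is proved; no named fact is introduced.

## References

* O. Regev, *On lattices, learning with errors, random linear codes, and cryptography*, J. ACM 56 (2009),
  art. 34, Lemma 3.12 (proof), §2 p. 11 [Regev2009].
* L. Grover, T. Rudolph, arXiv:quant-ph/0208112 (2002), eq. (5) [GroverRudolph2002].
-/

noncomputable section

namespace Literature.Computability.Cryptography

namespace Regev2009

namespace SamplerRegs

open Literature.Computability.QuantumComplexity Literature.Computability.QuantumComplexity.GaussianCells
  Literature.Computability.QuantumComplexity.GroverRudolph Literature.Computability.Complexity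
  Literature.Computability.Complexity.GaussIntegral Finset
open scoped Real

/-! ### The total cell mass is bounded below -/

/-- `∫₀¹ e^{-ct²} dt ≥ 1/3` for `c ≤ 1` (the integrand is at least `e^{-1} > 1/3`). [folklore] -/
theorem third_le_gaussF_one {c : ℝ} (hc1 : c ≤ 1) : (3 : ℝ)⁻¹ ≤ gaussF c 1 := by
  have hmono := intervalIntegral.integral_mono_on zero_le_one
    (intervalIntegrable_const (c := Real.exp (-1)) (μ := MeasureTheory.volume) (a := 0) (b := 1))
    (intervalIntegrable_integrand c 0 1)
    (fun t ht => by
      apply Real.exp_le_exp.2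
      have h1 : t ^ 2 ≤ 1 := by
        have := ht.1; have := ht.2; nlinarith
      nlinarith)
  have he : (3 : ℝ)⁻¹ ≤ Real.exp (-1) := by
    rw [Real.exp_neg]
    exact inv_anti₀ (Real.exp_pos 1) (Real.exp_one_lt_d9.le.trans (by norm_num))
  rw [intervalIntegral.integral_const, sub_zero, one_smul] at hmono
  unfold gaussF
  exact he.trans hmono

/-- **The total cell mass is at least `1/3`**: `W = G(c, 2^ℓ − 2^{ℓ-1}) + G(c, 2^{ℓ-1}) ≥ G(c, 1) ≥ 1/3`
for `c ≤ 1`. [cite: Regev2009, Lemma 3.12 (proof)] -/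
theorem third_le_total_cellW (ℓ : ℕ) {c : ℝ} (hc1 : c ≤ 1) : (3 : ℝ)⁻¹ ≤ total (cellW ℓ c) := by
  rw [total_cellW ℓ c (fun _ => false), gaussF_neg, sub_neg_eq_add]
  have h1 : 0 ≤ gaussF c ((2 : ℝ) ^ ℓ - (2 : ℝ) ^ (ℓ - 1)) :=
    gaussF_nonneg c (sub_nonneg.2 (pow_le_pow_right₀ one_le_two (Nat.sub_le ℓ 1)))
  have h2 : gaussF c 1 ≤ gaussF c ((2 : ℝ) ^ (ℓ - 1)) := gaussF_mono c (one_le_pow₀ one_le_two)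
  linarith [third_le_gaussF_one hc1]

/-! ### The generic bound on `etaCos` -/

/-- **`etaCos ≤ 6ℓ√ε + 2c(2·2^ℓ + 1)`** when the three precision terms are below `ε ≤ 1`:
`2/2^{k_A} ≤ ε`, `3(2/2^p)/μ ≤ ε²`, `2^ℓ μ ≤ ε²` (and `c ≤ 1`). [cite: Regev2009, Lemma 3.12 (proof)] [cite: GroverRudolph2002, eq. (5)] -/
theorem etaCos_le {ℓ kA p : ℕ} {μ c ε : ℝ} (hc1 : c ≤ 1) (hε0 : 0 ≤ ε) (hε1 : ε ≤ 1)
    (h1 : 2 / (2 : ℝ) ^ kA ≤ ε) (h2 : 3 * (2 / (2 : ℝ) ^ p) / μ ≤ ε ^ 2) (h3 : 2 ^ ℓ * μ ≤ ε ^ 2) :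
    etaCos ℓ kA p μ c ≤ ℓ * (6 * Real.sqrt ε) + 2 * (c * (2 * 2 ^ ℓ + 1)) := by
  unfold etaCos
  have hW := third_le_total_cellW ℓ hc1
  have hW0 : 0 < total (cellW ℓ c) := lt_of_lt_of_le (by norm_num) hW
  set ε₀ : ℝ := 2 / (2 : ℝ) ^ kA + Real.sqrt (3 * (2 / (2 : ℝ) ^ p) / μ) with hε₀
  have hs : Real.sqrt (3 * (2 / (2 : ℝ) ^ p) / μ) ≤ ε := by
    rw [← Real.sqrt_sq hε0]; exact Real.sqrt_le_sqrt h2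
  have hε₀0 : 0 ≤ ε₀ := add_nonneg (by positivity) (Real.sqrt_nonneg _)
  have hε₀2 : ε₀ ≤ 2 * ε := by linarith
  have hεε : ε ^ 2 ≤ ε := by nlinarith
  have hεs : ε ≤ Real.sqrt ε := by
    conv_lhs => rw [← Real.sqrt_sq hε0]
    exact Real.sqrt_le_sqrt hεε
  have h4 : Real.sqrt 4 = 2 := by
    rw [show (4 : ℝ) = 2 ^ 2 by norm_num, Real.sqrt_sq (by norm_num : (0 : ℝ) ≤ 2)]
  have h36 : Real.sqrt 36 = 6 := by
    rw [show (36 : ℝ) = 6 ^ 2 by norm_num, Real.sqrt_sq (by norm_num : (0 : ℝ) ≤ 6)]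
  have hmax : max (Real.sqrt (2 * ε₀)) ε₀ ≤ 2 * Real.sqrt ε := by
    refine max_le ?_ (by linarith)
    calc Real.sqrt (2 * ε₀) ≤ Real.sqrt (4 * ε) := Real.sqrt_le_sqrt (by linarith)
      _ = 2 * Real.sqrt ε := by rw [Real.sqrt_mul (by norm_num : (0 : ℝ) ≤ 4), h4]
  have hmax0 : 0 ≤ max (Real.sqrt (2 * ε₀)) ε₀ := le_max_of_le_right hε₀0
  have hsq : max (Real.sqrt (2 * ε₀)) ε₀ ^ 2 ≤ 4 * ε := by
    calc max (Real.sqrt (2 * ε₀)) ε₀ ^ 2 ≤ (2 * Real.sqrt ε) ^ 2 := pow_le_pow_left₀ hmax0 hmax 2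
      _ = 4 * ε := by rw [mul_pow, Real.sq_sqrt hε0]; ring
  have hfrac : 2 ^ ℓ * μ / total (cellW ℓ c) ≤ 3 * ε ^ 2 := by
    rw [div_le_iff₀ hW0]
    nlinarith [sq_nonneg ε]
  have hsum : 2 * max (Real.sqrt (2 * ε₀)) ε₀ ^ 2 + 8 * (2 ^ ℓ * μ / total (cellW ℓ c)) ≤ 36 * ε := by nlinarith
  have hroot : Real.sqrt (2 * max (Real.sqrt (2 * ε₀)) ε₀ ^ 2 + 8 * (2 ^ ℓ * μ / total (cellW ℓ c))) ≤ 6 * Real.sqrt ε := by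
    calc _ ≤ Real.sqrt (36 * ε) := Real.sqrt_le_sqrt hsum
      _ = 6 * Real.sqrt ε := by rw [Real.sqrt_mul (by norm_num : (0 : ℝ) ≤ 36), h36]
  exact add_le_add (mul_le_mul_of_nonneg_left hroot (Nat.cast_nonneg ℓ)) le_rfl

/-! ### The schedule -/

/-- The schedule's bad-mass threshold is positive. [folklore] -/
theorem schedule_mu_pos (ℓ m : ℕ) : (0 : ℝ) < 8 / 4 ^ (2 * m + ℓ + 3) := by positivity

/-- The schedule's table precision is below the bad-mass threshold: `4·(2/2^p) ≤ μ`. [folklore] -/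
theorem schedule_delta_le_mu (ℓ m : ℕ) : 4 * (2 / (2 : ℝ) ^ (4 * (2 * m + ℓ + 3))) ≤ 8 / 4 ^ (2 * m + ℓ + 3) := by
  rw [show (4 : ℝ) * (2 / 2 ^ (4 * (2 * m + ℓ + 3))) = 8 / 16 ^ (2 * m + ℓ + 3) by
    rw [pow_mul, show ((2 : ℝ) ^ 4) = 16 by norm_num]; ring]
  gcongr
  norm_num

/-- `2/2^{2m+1} = (2^{-m})²`. [folklore] -/
theorem two_div_pow_two_mul_add_one (m : ℕ) : (2 : ℝ) / 2 ^ (2 * m + 1) = ((2⁻¹ : ℝ) ^ m) ^ 2 := by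
  rw [show ((2⁻¹ : ℝ) ^ m) ^ 2 = ((2 : ℝ) ^ (2 * m))⁻¹ by rw [← pow_mul, inv_pow, Nat.mul_comm], pow_succ]
  field_simp

/-- `3(2/2^{4v})/(8/4^v) ≤ (2^{-m})⁴` for `v = 2m + ℓ + 3`. [folklore] -/
theorem schedule_h2 (ℓ m : ℕ) :
    3 * (2 / (2 : ℝ) ^ (4 * (2 * m + ℓ + 3))) / (8 / 4 ^ (2 * m + ℓ + 3)) ≤ (((2⁻¹ : ℝ) ^ m) ^ 2) ^ 2 := by
  have h16 : (2 : ℝ) ^ (4 * (2 * m + ℓ + 3)) = 4 ^ (2 * m + ℓ + 3) * 4 ^ (2 * m + ℓ + 3) := by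
    rw [pow_mul, show ((2 : ℝ) ^ 4) = 4 * 4 by norm_num, mul_pow]
  rw [h16]
  have h4 : (0 : ℝ) < 4 ^ (2 * m + ℓ + 3) := by positivity
  rw [div_le_iff₀ (by positivity), show (3 : ℝ) * (2 / (4 ^ (2 * m + ℓ + 3) * 4 ^ (2 * m + ℓ + 3))) =
    (3 / 4) * (4 ^ (2 * m + ℓ + 3))⁻¹ * (8 / 4 ^ (2 * m + ℓ + 3)) by field_simp; ring]
  refine mul_le_mul_of_nonneg_right ?_ (by positivity)
  have hx : (((2⁻¹ : ℝ) ^ m) ^ 2) ^ 2 = ((4 : ℝ) ^ (2 * m))⁻¹ := by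
    rw [← pow_mul, ← pow_mul, inv_pow, show (4 : ℝ) = 2 ^ 2 by norm_num, ← pow_mul]; ring_nf
  rw [hx]
  calc (3 : ℝ) / 4 * (4 ^ (2 * m + ℓ + 3))⁻¹ ≤ 1 * (4 ^ (2 * m + ℓ + 3))⁻¹ := by gcongr; norm_num
    _ = (4 ^ (2 * m + ℓ + 3))⁻¹ := one_mul _
    _ ≤ ((4 : ℝ) ^ (2 * m))⁻¹ := by
      refine inv_anti₀ (by positivity) (pow_le_pow_right₀ (by norm_num) (by omega))

/-- `2^ℓ · 8/4^{2m+ℓ+3} ≤ (2^{-m})⁴`. [folklore] -/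
theorem schedule_h3 (ℓ m : ℕ) : (2 : ℝ) ^ ℓ * (8 / 4 ^ (2 * m + ℓ + 3)) ≤ (((2⁻¹ : ℝ) ^ m) ^ 2) ^ 2 := by
  have hx : (((2⁻¹ : ℝ) ^ m) ^ 2) ^ 2 = ((4 : ℝ) ^ (2 * m))⁻¹ := by
    rw [← pow_mul, ← pow_mul, inv_pow, show (4 : ℝ) = 2 ^ 2 by norm_num, ← pow_mul]; ring_nf
  rw [hx, pow_add, pow_add, show (4 : ℝ) ^ ℓ = 2 ^ ℓ * 2 ^ ℓ by rw [show (4 : ℝ) = 2 * 2 by norm_num, mul_pow]]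
  have h2 : (0 : ℝ) < 2 ^ ℓ := by positivity
  have h4 : (0 : ℝ) < 4 ^ (2 * m) := by positivity
  rw [show (2 : ℝ) ^ ℓ * (8 / (4 ^ (2 * m) * (2 ^ ℓ * 2 ^ ℓ) * 4 ^ 3)) = (4 ^ (2 * m))⁻¹ * ((8 / 4 ^ 3) * (2 ^ ℓ)⁻¹) by
    field_simp]
  refine mul_le_of_le_one_right (by positivity) ?_
  have h1 : ((2 : ℝ) ^ ℓ)⁻¹ ≤ 1 := inv_le_one_of_one_le₀ (one_le_pow₀ one_le_two)
  have h0 : 0 ≤ ((2 : ℝ) ^ ℓ)⁻¹ := by positivity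
  nlinarith

/-- **The scheduled one-block error**: with `k_A := 2m+1`, `p := 4(2m+ℓ+3)`, `μ := 8/4^{2m+ℓ+3}`,
`etaCos ≤ 6ℓ·2^{-m} + 2c(2·2^ℓ + 1)` (`c ≤ 1`). [cite: Regev2009, Lemma 3.12 (proof), §2 p. 11] -/
theorem etaCos_schedule_le (ℓ m : ℕ) {c : ℝ} (hc1 : c ≤ 1) :
    etaCos ℓ (2 * m + 1) (4 * (2 * m + ℓ + 3)) (8 / 4 ^ (2 * m + ℓ + 3)) c ≤
      ℓ * (6 * (2⁻¹ : ℝ) ^ m) + 2 * (c * (2 * 2 ^ ℓ + 1)) := by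
  have hx0 : (0 : ℝ) ≤ (2⁻¹ : ℝ) ^ m := by positivity
  have h := etaCos_le (ℓ := ℓ) (kA := 2 * m + 1) (p := 4 * (2 * m + ℓ + 3)) (μ := 8 / 4 ^ (2 * m + ℓ + 3))
    (ε := ((2⁻¹ : ℝ) ^ m) ^ 2) hc1 (by positivity) (by
      rw [← pow_mul]; exact pow_le_one₀ (by norm_num) (by norm_num))
    (two_div_pow_two_mul_add_one m).le (schedule_h2 ℓ m) (schedule_h3 ℓ m)
  rwa [Real.sqrt_sq hx0] at h

end SamplerRegs

end Regev2009

end Literature.Computability.Cryptography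

end
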